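import Summits.ResolutionOfSingularities.ResolutionOfSingularities.Theorems.FrobeniusLadderFInjectiveMacaulayficationFCUnguardedRungs
import Summits.ResolutionOfSingularities.ResolutionOfSingularities.Theorems.FrobeniusLadderFInjectiveMacaulayficationLocFixAtNonClosedLowDim
import Literature.AlgebraicGeometry.Resolution.CanonicalResolutionSmoothCentre
import HarnessLib

/-!
# FC″ in dimension ≥ 4 at a bad non-closed point of local dimension 2 or 3 — the (A′) route, typed: targets (T1′)/(T1″)/(T2′)/(T3′),
# the PROVED assembly `fcUnguardedLowDim_of_aprime`, (T1′) discharged modulo named facts, and the SPLITTER of the door stub `stub_fcUnguarded`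
# by the local dimension at `η` (crux `FInjectiveMacaulayfication` stmt-ResolutionOfSingularities-15315, chain w45a; TEXT OF RECORD =
# FC2Dim4Sig v0.7 `e54c78aab5d13002` of res-L1-w45a-stub-3 g5 (after res-L1-w45a-strat-1 v0.5 `2c3abaa93032697b`), booked res-L1-w45a-plan-1
# R16.12 (1)–(2); tree-landing by res-L1-w45a-stub-1 g6, R16.13 (1))

[OURS · L1 W4.5a] Support file (`--supports stmt-ResolutionOfSingularities-15315 --as helper`); NOT a statement of any manuscript;
AI-written (AI review is weaker than expert review). Every `@[conjecture] def` is a CANDIDATE statement of OURS, consumed only as a hypothesis;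
nothing here is a Literature fact; `Prop`-valued defs only (no instances, no notation). Binder texts of §0–§3 = FC2Dim4Sig v0.7 VERBATIM.

THE (A′) ROUTE (stub-3 v0.7, plan-1 R16.12/R16.14). `stub_fcUnguarded` (= `GenericFibreReduction.FCUnguarded`) is reduced by
`FCUnguardedRungs.fcUnguarded_of_rungs` to dims ≤ 2, = 3 (done modulo facts) and the residual `FCUnguardedDimGe4`; at a non-closed bad `η`
of LOCAL dimension 2 or 3 the (A′) route gives FC″ from (T1″) `LocFixFullAtNonClosed` (FULL local datum; its over-`𝔪_η` shadow (T1′)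
`LocFixAtNonClosed` is a THEOREM modulo named facts, `locFixAtNonClosed_of_facts` = p564701), (T2′) `SpreadGoodAprime` (folklore modulo #2 +
`CMLocusOpen`) and (T3′) — RESIDUAL OF RECORD in the POWER form `RelClosedSubsetFixPow` (R16.14: agreement off `Z` only up to `J₀ⁿ`; the
exact form `RelClosedSubsetFix` is kept, NOT load-bearing) — by the PROVED assembly `fcUnguardedLowDim_of_aprime` (§3; its pow twin is a
follow-up kernel). §4 splits `FCUnguardedDimGe4` EXHAUSTIVELY by `dim 𝒪_η` (`≤ 1`: `FCUnguardedLocDimLe1`, the primary curve rung;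
`2…3`: `FCUnguardedLowDim`; `≥ 4`: `FCUnguardedLocDimGe4`, the d ≥ 5 residual): `fcUnguardedDimGe4_of_parts`, `fcUnguarded_of_parts` = the
splitter by which door v31 decomposes `stub_fcUnguarded`. [folklore assembly; no named fact is asserted]
-/

-- single-problem summit: the doubled namespace component is forced
set_option linter.dupNamespace false

noncomputable section

open AlgebraicGeometry CategoryTheory Literature.AlgebraicGeometry.Resolution TopologicalSpace IsLocalRing

namespace Summit.ResolutionOfSingularities.ResolutionOfSingularities.Theorems.FInjectiveMacaulayfication.FCUnguardedAprime

open Summit.ResolutionOfSingularities.ResolutionOfSingularities.Theorems.FInjectiveMacaulayfication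
open Summit.ResolutionOfSingularities.ResolutionOfSingularities.Theorems.FInjectiveMacaulayfication.SliceableCentre (CMCl FCl FullCl)

/-! ## §0 Packaging (v0.7 verbatim) -/

/-- «Every blow-up of `X₁` along `J` is FULL at the NON-closed points over `S` and CM (clause sense) at the CLOSED points over `S`» —
the shape of FC″'s (nc) ∧ (cl) with `S = supp J ∖ {η}`. [folklore; OURS abbreviation] -/
abbrev GoodOver (p : ℕ) (X₁ : Scheme.{0}) (J : X₁.IdealSheafData) (S : Set X₁) : Prop :=
  ∀ (X₂ : Scheme.{0}) (π : X₂ ⟶ X₁), IsBlowup π J →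
    (∀ x : X₂, π.base x ∈ S → ¬ IsClosed ({x} : Set X₂) → FullCl p (X₂.presheaf.stalk x)) ∧
    (∀ x : X₂, π.base x ∈ S → IsClosed ({x} : Set X₂) → CMCl (X₂.presheaf.stalk x))

/-- LocFix datum at `η`, currency (A′) of FC″ (verbatim shape): `(c′) ≠ ⊥`, `(c′) ≤ 𝔪_η`, affine blow-up charts FULL over `𝔪_η`. [OURS abbreviation] -/
abbrev LocFixData (p : ℕ) (X₁ : Scheme.{0}) (η : X₁) (n' : ℕ) (c' : Fin n' → X₁.presheaf.stalk η) : Prop :=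
  Ideal.span (Set.range c') ≠ ⊥ ∧ Ideal.span (Set.range c') ≤ maximalIdeal (X₁.presheaf.stalk η) ∧
    ∀ (j : Fin n') (𝔔 : PrimeSpectrum (blowupAlgebra (Ideal.span (Set.range c')) (c' j))),
      𝔔.asIdeal.comap (algebraMap (X₁.presheaf.stalk η) (blowupAlgebra (Ideal.span (Set.range c')) (c' j))) =
        maximalIdeal (X₁.presheaf.stalk η) → FullCl p (Localization.AtPrime 𝔔.asIdeal)

/-- «v0.7» FULL LocFix datum at `η`, currency (A′-full): `(c′) ≠ ⊥`, `(c′) ≤ 𝔪_η`, and ALL primes of ALL affine blow-up charts FULL — i.e.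
`Bl_{(c′)} Spec 𝒪_{X₁,η}` is FULL everywhere: over `𝔪_η`, over the proper generizations of `η` inside `V(c′)`, and (automatically, for good
generizations) off `V(c′)` where the chart is a localisation of `𝒪_{X₁,y}`. This — not `LocFixData` — is what the spread (T2′) of a NON-primary
centre consumes: a bare `LocFixData` says nothing about the blow-up over the generizations of `η` that lie in `V(c′)`. [OURS abbreviation] -/
abbrev LocFixDataFull (p : ℕ) (X₁ : Scheme.{0}) (η : X₁) (n' : ℕ) (c' : Fin n' → X₁.presheaf.stalk η) : Prop :=
  Ideal.span (Set.range c') ≠ ⊥ ∧ Ideal.span (Set.range c') ≤ maximalIdeal (X₁.presheaf.stalk η) ∧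
    ∀ (j : Fin n') (𝔔 : PrimeSpectrum (blowupAlgebra (Ideal.span (Set.range c')) (c' j))), FullCl p (Localization.AtPrime 𝔔.asIdeal)

/-- «v0.7» A FULL datum is in particular an (A′) datum. [plumbing] -/
theorem locFixData_of_full {p : ℕ} {X₁ : Scheme.{0}} {η : X₁} {n' : ℕ} {c' : Fin n' → X₁.presheaf.stalk η}
    (h : LocFixDataFull p X₁ η n' c') : LocFixData p X₁ η n' c' :=
  ⟨h.1, h.2.1, fun j 𝔔 _ => h.2.2 j 𝔔⟩

/-! ## §1 The target of the (A′) route: FC″(dim ≥ 4) at `η` of local dimension 2 or 3 (v0.7 verbatim) -/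

/-- [OURS · CANDIDATE statement, not a fact] [OURS · candidate statement — v0.7] **FC″ at a non-closed bad point of LOCAL DIMENSION 2 OR 3 of a scheme of dimension ≥ 4** —
`FCUnguardedRungs.FCUnguardedDimGe4` VERBATIM with `2 ≤ ringKrullDim 𝒪_η → ringKrullDim 𝒪_η ≤ 3 →` inserted before the conclusion (in place of
`FCUnguardedCurve`'s coheight-one hypothesis: on a 4-fold a coheight-one `η` has `dim 𝒪_η = 3`, so this COVERS the curve case there, and also the
coheight-two points; what it omits is `dim 𝒪_η = 1` — the PRIMARY curve rung `PointFixAtNonClosedWildCurve` + (T2) + (T3) — and `dim 𝒪_η ≥ 4`,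
which only occurs for `dim X₁ ≥ 5` = the declared residual of the d ≥ 5 recursion). PROVED below from (T1″) + (T2′) + (T3′)
(`fcUnguardedLowDim_of_aprime`). [candidate statement, OURS] -/
@[conjecture] def FCUnguardedLowDim : Prop :=
  ∀ (p : ℕ), p.Prime → ∀ (k : Type) [Field k] [CharP k p]
    (X₁ : Scheme.{0}) (f₁ : X₁ ⟶ Spec (.of k)),
      IsSeparated f₁ → LocallyOfFiniteType f₁ → QuasiCompact f₁ → IsIntegral X₁ → 4 ≤ topologicalKrullDim X₁ →
      (∀ x : X₁, (∀ d : ℕ, ringKrullDim (X₁.presheaf.stalk x) = d → ∀ s : Fin d → X₁.presheaf.stalk x,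
        (Ideal.span (Set.range s)).radical.IsMaximal → RingTheory.Sequence.IsWeaklyRegular (X₁.presheaf.stalk x) (List.ofFn s))) →
      ∀ η : X₁, (¬ IsClosed ({η} : Set X₁) ∧ ¬ (∀ d : ℕ, ringKrullDim (X₁.presheaf.stalk η) = d → ∀ s : Fin d → X₁.presheaf.stalk η,
          (Ideal.span (Set.range s)).radical.IsMaximal → ∀ t : X₁.presheaf.stalk η, (∃ e : ℕ, t ^ p ^ e ∈
            Ideal.span ((fun z : X₁.presheaf.stalk η => z ^ p ^ e) '' (Ideal.span (Set.range s) : Set (X₁.presheaf.stalk η)))) →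
              t ∈ Ideal.span (Set.range s)) ∧
        ∀ y : X₁, y ⤳ η → y ≠ η → (∀ d : ℕ, ringKrullDim (X₁.presheaf.stalk y) = d → ∀ s : Fin d → X₁.presheaf.stalk y,
          (Ideal.span (Set.range s)).radical.IsMaximal → ∀ t : X₁.presheaf.stalk y, (∃ e : ℕ, t ^ p ^ e ∈
            Ideal.span ((fun z : X₁.presheaf.stalk y => z ^ p ^ e) '' (Ideal.span (Set.range s) : Set (X₁.presheaf.stalk y)))) →
              t ∈ Ideal.span (Set.range s))) →
      -- «v0.7» local dimension 2 or 3 at η (the regime of the (A′) rungs; dim 𝒪_η = 1 is the primary curve rung, ≥ 4 the d ≥ 5 recursion)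
      2 ≤ ringKrullDim (X₁.presheaf.stalk η) → ringKrullDim (X₁.presheaf.stalk η) ≤ 3 →
      ∃ (J : X₁.IdealSheafData) (n' : ℕ) (c' : Fin n' → X₁.presheaf.stalk η), J ≠ ⊥ ∧ η ∈ (J.support : Set X₁) ∧
      -- the RE-CHOSEN LocFix datum c' at η (currency (A′)): nonzero, inside 𝔪_η, charts FULL over 𝔪_η
      Ideal.span (Set.range c') ≠ ⊥ ∧ Ideal.span (Set.range c') ≤ maximalIdeal (X₁.presheaf.stalk η) ∧
        (∀ (j : Fin n') (𝔔 : PrimeSpectrum (blowupAlgebra (Ideal.span (Set.range c')) (c' j))),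
          𝔔.asIdeal.comap (algebraMap (X₁.presheaf.stalk η) (blowupAlgebra (Ideal.span (Set.range c')) (c' j))) =
            maximalIdeal (X₁.presheaf.stalk η) →
          IsDomain (Localization.AtPrime 𝔔.asIdeal) ∧ ∀ d : ℕ, ringKrullDim (Localization.AtPrime 𝔔.asIdeal) = d →
            ∀ s : Fin d → Localization.AtPrime 𝔔.asIdeal, (Ideal.span (Set.range s)).radical.IsMaximal →
              RingTheory.Sequence.IsWeaklyRegular (Localization.AtPrime 𝔔.asIdeal) (List.ofFn s) ∧
              ∀ y : Localization.AtPrime 𝔔.asIdeal, (∃ e : ℕ, y ^ p ^ e ∈ Ideal.span ((fun z : Localization.AtPrime 𝔔.asIdeal => z ^ p ^ e) ''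
                (Ideal.span (Set.range s) : Set (Localization.AtPrime 𝔔.asIdeal)))) → y ∈ Ideal.span (Set.range s)) ∧
      stalkIdeal J η = Ideal.span (Set.range c') ∧
      (∀ (X₂ : Scheme.{0}) (π : X₂ ⟶ X₁), IsBlowup π J →
        (∀ x : X₂, π.base x ∈ (J.support : Set X₁) → π.base x ≠ η → ¬ IsClosed ({x} : Set X₂) →
          IsDomain (X₂.presheaf.stalk x) ∧ ∀ d : ℕ, ringKrullDim (X₂.presheaf.stalk x) = d → ∀ s : Fin d → X₂.presheaf.stalk x,
            (Ideal.span (Set.range s)).radical.IsMaximal → RingTheory.Sequence.IsWeaklyRegular (X₂.presheaf.stalk x) (List.ofFn s) ∧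
            ∀ t : X₂.presheaf.stalk x, (∃ e : ℕ, t ^ p ^ e ∈ Ideal.span ((fun z : X₂.presheaf.stalk x => z ^ p ^ e) ''
              (Ideal.span (Set.range s) : Set (X₂.presheaf.stalk x)))) → t ∈ Ideal.span (Set.range s)) ∧
        (∀ x : X₂, π.base x ∈ (J.support : Set X₁) → IsClosed ({x} : Set X₂) →
          ∀ d : ℕ, ringKrullDim (X₂.presheaf.stalk x) = d → ∀ s : Fin d → X₂.presheaf.stalk x,
            (Ideal.span (Set.range s)).radical.IsMaximal → RingTheory.Sequence.IsWeaklyRegular (X₂.presheaf.stalk x) (List.ofFn s)))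

/-! ## §2 The three inputs (T1′)/(T1″), (T2′), (T3′) (v0.7 verbatim) -/

/-- [OURS · CANDIDATE statement, not a fact] «v0.7» [OURS · THEOREM modulo named facts] **(T1′) the (A′) LocFix datum at a non-closed bad point of local dimension 2 or 3, TAME OR
WILD**: the binders of `PointFixAtNonClosedWild` minus `¬ IsIntegrallyClosed 𝒪_η`, conclusion `LocFixData` (no radical condition). PROVED in the
tree: `LocFixAtNonClosedLowDim.locFixAprime_atNonClosed_lowDim` (p564701) — dim 2 ⟸ Lipman (`TameWildSplit.closedCentreExistsAffineDimLe2_of_lipman`,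
p554313), dim 3 ⟸ Cossart–Piltant (`ClosedCentreDimEq3.closedCentreExistsDimEq3_of_cp`), both through the generic-fibre model
(`GenericFibreModel.genericFibreModel`, closed avatar `b` with `dim X₀ = dim 𝒪_η`), the adapter `WFixAtNonClosedDimTwo.locFixAprime_of_centreData`
(global `CentreData` ⇒ affine-chart statement over `𝔪_b`, via `IsBlowup.exists_point_of_blowupAlgebra_prime`) and the transport
`WFixAtNonClosedDimTwo.locFixAprime_of_ringEquiv`; see `locFixAtNonClosed_of_facts`. [candidate statement, OURS; THEOREM modulo Lipman1978 +
CossartPiltant2019 (General, Principalization) + Stacks081R + DattaMurayama2024 Thm. B + CMLocusOpen] -/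
@[conjecture] def LocFixAtNonClosed : Prop :=
  ∀ (p : ℕ), p.Prime → ∀ (k : Type) [Field k] [CharP k p]
    (X₁ : Scheme.{0}) (f₁ : X₁ ⟶ Spec (.of k)),
      IsSeparated f₁ → LocallyOfFiniteType f₁ → QuasiCompact f₁ → IsIntegral X₁ → 4 ≤ topologicalKrullDim X₁ →
      (∀ x : X₁, CMCl (X₁.presheaf.stalk x)) →
      ∀ η : X₁, ¬ IsClosed ({η} : Set X₁) → ¬ FCl p (X₁.presheaf.stalk η) →
        2 ≤ ringKrullDim (X₁.presheaf.stalk η) → ringKrullDim (X₁.presheaf.stalk η) ≤ 3 →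
        (∀ y : X₁, y ⤳ η → y ≠ η → FCl p (X₁.presheaf.stalk y)) →
        ∃ (n' : ℕ) (c' : Fin n' → X₁.presheaf.stalk η), LocFixData p X₁ η n' c'

/-- «v0.7» **(T1′) HOLDS modulo the named facts** — by the tree theorem `LocFixAtNonClosedLowDim.locFixAprime_atNonClosed_lowDim` (p564701).
[folklore assembly; cite: Lipman1978; CossartPiltant2019, Thm. 1.1; DattaMurayama2024, Thm. B] -/
theorem locFixAtNonClosed_of_facts
    (hL : Literature.AlgebraicGeometry.Resolution.Lipman1978SequenceFinite.{0})
    (hG : Literature.AlgebraicGeometry.Resolution.CossartPiltant2019General.{0})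
    (h081R : Literature.AlgebraicGeometry.Resolution.Stacks081R.{0})
    (hP : Literature.AlgebraicGeometry.Resolution.CossartPiltant2019Principalization.{0})
    (hDM : Literature.AlgebraicGeometry.Resolution.DattaMurayama2024_fInjectiveLocusOpen.{0})
    (hCMo : NonFullLocusClosed.CMLocusOpen) : LocFixAtNonClosed :=
  fun p hp k _ _ X₁ f₁ hs hft hqc hi h4 hCM η hη hbad h2 h3 hgen =>
    LocFixAtNonClosedLowDim.locFixAprime_atNonClosed_lowDim hL hG h081R hP hDM hCMo p hp k X₁ f₁ hs hft hqc hi h4 hCM η hη hbad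
      h2 h3 hgen

/-- [OURS · CANDIDATE statement, not a fact] «v0.7» [OURS · candidate statement, EXPECTED from the same inputs] **(T1″) the FULL (A′) datum at a non-closed bad point of local dimension
2 or 3** (`LocFixDataFull`: ALL chart primes FULL). Why expected: on the closed-point model `(X₀ ⊇ U ∋ b)` the `CentreData` `J` makes EVERY
blow-up point over `supp J` FULL, not only those over `b`; a chart prime `𝔔` of `𝒪_b[(c)/c_j]` over `q ⊊ 𝔪_b` is the local ring of a blow-up
point over the generization `y₀` of `b` with prime `q` when `q ⊇ (c)` (`y₀ ∈ supp J` ⇒ FULL), and the localisation `(𝒪_b)_q ≅ 𝒪_{X₁,y}` of a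
GOOD proper generization of `η` when `q ⊉ (c)` (FULL: domain, CM by hypothesis, `FCl` by maximality of `η`). MISSING ADAPTER (one lemma, the
general-prime twin of the tree's `IsBlowup.exists_point_of_blowupAlgebra_prime`, Stacks 0804):
`∀ (hπ : IsBlowup π J) (s : X) (c : Fin k → 𝒪_{X,s}) (hc : span c = stalkIdeal J s) (j) (𝔔 : PrimeSpectrum (blowupAlgebra (span c) (c j))),
∃ x' : X', π x' = X.fromSpecStalk s ⟨𝔔.asIdeal.comap (algebraMap _ _), _⟩ ∧ Nonempty (𝒪_{X',x'} ≃+* Localization.AtPrime 𝔔.asIdeal)`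
(same proof: the chart morphism `Spec B_j → X' ×_X Spec 𝒪_{X,s} → X'` without the restriction to the closed point). [candidate statement, OURS;
expected] -/
@[conjecture] def LocFixFullAtNonClosed : Prop :=
  ∀ (p : ℕ), p.Prime → ∀ (k : Type) [Field k] [CharP k p]
    (X₁ : Scheme.{0}) (f₁ : X₁ ⟶ Spec (.of k)),
      IsSeparated f₁ → LocallyOfFiniteType f₁ → QuasiCompact f₁ → IsIntegral X₁ → 4 ≤ topologicalKrullDim X₁ →
      (∀ x : X₁, CMCl (X₁.presheaf.stalk x)) →
      ∀ η : X₁, ¬ IsClosed ({η} : Set X₁) → ¬ FCl p (X₁.presheaf.stalk η) →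
        2 ≤ ringKrullDim (X₁.presheaf.stalk η) → ringKrullDim (X₁.presheaf.stalk η) ≤ 3 →
        (∀ y : X₁, y ⤳ η → y ≠ η → FCl p (X₁.presheaf.stalk y)) →
        ∃ (n' : ℕ) (c' : Fin n' → X₁.presheaf.stalk η), LocFixDataFull p X₁ η n' c'

/-- [OURS · CANDIDATE statement, not a fact] «v0.7» [OURS · candidate statement] **(T2′) spread of a FULL (A′) datum** (NON-primary centre allowed): some ideal sheaf `J ≠ ⊥` with
`stalkIdeal J η = (c′)` is good over `supp J ∩ U` for an open `U ∋ η` — FULL at the non-closed blow-up points, CM at the closed ones (in fact FULL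
at all of them). Folklore modulo #2 (`hDM`), `CMLocusOpen`, properness of blow-ups and flat base change along `Spec 𝒪_{X₁,η} → X₁`: take any
coherent extension `J` of `(c′)`; ONE blow-up `X₂ → X₁` along `J` has, over the generizations of `η`, the local rings of `Bl_{(c′)} Spec 𝒪_η`
(FULL by the datum, via `IsBlowup.pullback_snd_of_flat` + the chart–stalk dictionary `IsBlowup.exists_blowupAlgebra_stalk_ringEquiv`); the bad
locus of the admissible `X₂` is closed, its proper image `B` is closed and misses `η`; `U := X₁ ∖ B`; any other blow-up along `J` is `X₂` up to
unique isomorphism (`IsBlowup.unique`). NOTE `supp J ⊇ closure V(c′)` may be STRICTLY BIGGER than `closure {η}` (it contains the non-normal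
stratum through a wild `η`): the price of the (A′)-currency, paid in (T3′). [candidate statement, OURS; folklore modulo the two openness facts] -/
@[conjecture] def SpreadGoodAprime : Prop :=
  ∀ (p : ℕ), p.Prime → ∀ (k : Type) [Field k] [CharP k p]
    (X₁ : Scheme.{0}) (f₁ : X₁ ⟶ Spec (.of k)),
      IsSeparated f₁ → LocallyOfFiniteType f₁ → QuasiCompact f₁ → IsIntegral X₁ → 4 ≤ topologicalKrullDim X₁ →
      (∀ x : X₁, CMCl (X₁.presheaf.stalk x)) →
      ∀ (η : X₁) (n' : ℕ) (c' : Fin n' → X₁.presheaf.stalk η), LocFixDataFull p X₁ η n' c' →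
        ∃ (J : X₁.IdealSheafData) (U : X₁.Opens), J ≠ ⊥ ∧ η ∈ (J.support : Set X₁) ∧
          stalkIdeal J η = Ideal.span (Set.range c') ∧ η ∈ (U : Set X₁) ∧
          GoodOver p X₁ J ((J.support : Set X₁) ∩ (U : Set X₁))

/-- [OURS · CANDIDATE statement, not a fact] «v0.7» [OURS · candidate statement, OPEN — the RESIDUAL OF RECORD of the (A′) route] **(T3′) relative fix over a CLOSED SUBSET** — «modify
`J₀` ON `Z` only»: if every blow-up along `J₀` is good over `supp J₀ ∖ Z` for a closed `Z ⊆ supp J₀`, then some `J` with the SAME stalks as `J₀`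
off `Z` is good over all of `supp J`. For FINITE `Z` this is (T3) `RelClosedFix` iterated (T3⁰/T3⁺ reading of tri-2 #122); in the (A′) route
`Z = supp J₀ ∖ U` is in general POSITIVE-dimensional (on a 4-fold: the part outside `U` of the non-normal stratum through a wild `η` — curves and
surfaces), and (T3′) there is an embedded F-injectivisation ALONG `Z` with prescribed behaviour off `Z` = the R-WT / patching column of ROUTES-DIM4
§5, formerly carried inside `FCUnguardedCurveWildDeep`. Why it might fail: as (T3), one notch up in the dimension of the locus to be fixed; no
tool in print. Junk instances (`Z = supp J₀`: take `J = ⊤`) are harmless. «R16.14: EXACT agreement off `Z` is NOT load-bearing — the power variant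
`RelClosedSubsetFixPow` below is the residual of record; do not hunt this stronger statement.» [candidate statement, OURS; open] -/
@[conjecture] def RelClosedSubsetFix : Prop :=
  ∀ (p : ℕ), p.Prime → ∀ (k : Type) [Field k] [CharP k p]
    (X₁ : Scheme.{0}) (f₁ : X₁ ⟶ Spec (.of k)),
      IsSeparated f₁ → LocallyOfFiniteType f₁ → QuasiCompact f₁ → IsIntegral X₁ → 4 ≤ topologicalKrullDim X₁ →
      (∀ x : X₁, CMCl (X₁.presheaf.stalk x)) →
      ∀ (J₀ : X₁.IdealSheafData) (Z : Set X₁), IsClosed Z → Z ⊆ (J₀.support : Set X₁) →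
        GoodOver p X₁ J₀ ((J₀.support : Set X₁) \ Z) →
        ∃ J : X₁.IdealSheafData, (∀ x : X₁, x ∉ Z → stalkIdeal J x = stalkIdeal J₀ x) ∧
          GoodOver p X₁ J (J.support : Set X₁)

/-- [OURS · CANDIDATE · RESIDUAL OF RECORD (res-L1-w45a-plan-1 R16.14, after res-L1-w45a-tri-2 20:14:32Z)] **(T3′-pow) relative fix over a
closed subset, agreement off `Z` up to a positive POWER**: as `RelClosedSubsetFix`, but the new centre `J` agrees with `J₀ⁿ` (some `n > 0`)
off `Z`. Why this and not exact agreement: towers `Bl_K(Bl_{J₀} X₁) → X₁` with `K` cosupported over `Z` compose to ONE blow-up of `X₁` along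
`J₀^m · 𝔞` with `𝔞 ≡ J₀`-power off `Z` (Raynaud–Gruson / Stacks 080B), never to exact agreement (no `m`-th roots of ideals); the (A′) datum
survives powers (`Bl_{Iⁿ} = Bl_I`; degree-`n` monomial charts are open pieces of the FULL charts of `(c′)`), so the pow-assembly
`LocFixFullAtNonClosed → SpreadGoodAprime → RelClosedSubsetFixPow → FCUnguardedLowDim` closes with a chart lemma `locFixDataFull_pow`
(follow-up kernel file). Why it might fail: as (T3′). [candidate statement, OURS; open — residual of record] -/
@[conjecture] def RelClosedSubsetFixPow : Prop :=
  ∀ (p : ℕ), p.Prime → ∀ (k : Type) [Field k] [CharP k p]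
    (X₁ : Scheme.{0}) (f₁ : X₁ ⟶ Spec (.of k)),
      IsSeparated f₁ → LocallyOfFiniteType f₁ → QuasiCompact f₁ → IsIntegral X₁ → 4 ≤ topologicalKrullDim X₁ →
      (∀ x : X₁, CMCl (X₁.presheaf.stalk x)) →
      ∀ (J₀ : X₁.IdealSheafData) (Z : Set X₁), IsClosed Z → Z ⊆ (J₀.support : Set X₁) →
        GoodOver p X₁ J₀ ((J₀.support : Set X₁) \ Z) →
        ∃ (J : X₁.IdealSheafData) (n : ℕ), 0 < n ∧ (∀ x : X₁, x ∉ Z → stalkIdeal J x = stalkIdeal J₀ x ^ n) ∧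
          GoodOver p X₁ J (J.support : Set X₁)

/-- The exact form implies the power form (`n = 1`). [plumbing] -/
theorem relClosedSubsetFixPow_of_fix (h : RelClosedSubsetFix) : RelClosedSubsetFixPow :=
  fun p hp k _ _ X₁ f₁ hs hft hqc hi h4 hCM J₀ Z hZ hZJ hgood => by
    obtain ⟨J, hJeq, hJgood⟩ := h p hp k X₁ f₁ hs hft hqc hi h4 hCM J₀ Z hZ hZJ hgood
    exact ⟨J, 1, Nat.one_pos, fun x hx => by rw [pow_one]; exact hJeq x hx, hJgood⟩

/-! ## §3 The (A′) assembly: FC″(≥4) at `η` of local dimension 2 or 3 ⇐ (T1″) + (T2′) + (T3′) — PROVED (v0.7 verbatim) -/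

/-- «v0.7» [OURS · assembly, PROVED] **FC″(≥4) at a non-closed bad `η` with `2 ≤ dim 𝒪_η ≤ 3` from (T1″) + (T2′) + (T3′).** Take the FULL
datum `(c′)` at `η` (T1″); spread it (T2′) to `J₀ ≠ ⊥`, `stalkIdeal J₀ η = (c′)`, good over `supp J₀ ∩ U`, `η ∈ U`; `Z := supp J₀ ∖ U` is closed,
`⊆ supp J₀`, `∌ η`, and `supp J₀ ∖ Z = supp J₀ ∩ U`; (T3′) gives `J` with the same stalks off `Z` — so `stalkIdeal J η = (c′)`, whence `J ≠ ⊥`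
(`(c′) ≠ ⊥`) and `η ∈ supp J` (`(c′) ≤ 𝔪_η`) — good over all of `supp J`: FC″'s (nc) and (cl) clauses verbatim, and its (A′) conjunct is the
datum restricted to the primes over `𝔪_η`. [folklore assembly, OURS; no named fact] -/
theorem fcUnguardedLowDim_of_aprime (h₁ : LocFixFullAtNonClosed) (h₂ : SpreadGoodAprime) (h₃ : RelClosedSubsetFix) :
    FCUnguardedLowDim := by
  intro p hp k _ _ X₁ f₁ hs hft hqc hi h4 hCM η hη h2 h3
  obtain ⟨hηcl, hbad, hgen⟩ := hη
  obtain ⟨n', c', hfull⟩ := h₁ p hp k X₁ f₁ hs hft hqc hi h4 hCM η hηcl hbad h2 h3 hgen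
  obtain ⟨J₀, U, -, -, hstalk, hηU, hgood⟩ := h₂ p hp k X₁ f₁ hs hft hqc hi h4 hCM η n' c' hfull
  -- `Z := supp J₀ ∖ U`
  have hZcl : IsClosed ((J₀.support : Set X₁) \ (U : Set X₁)) := J₀.support.isClosed.sdiff U.isOpen
  have hZsub : (J₀.support : Set X₁) \ (U : Set X₁) ⊆ (J₀.support : Set X₁) := fun x hx => hx.1
  have hZeq : (J₀.support : Set X₁) \ ((J₀.support : Set X₁) \ (U : Set X₁)) = (J₀.support : Set X₁) ∩ (U : Set X₁) := by
    ext x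
    constructor
    · rintro ⟨hx, hx'⟩
      exact ⟨hx, by_contra fun hxU => hx' ⟨hx, hxU⟩⟩
    · rintro ⟨hx, hxU⟩
      exact ⟨hx, fun h => h.2 hxU⟩
  have hgoodZ : GoodOver p X₁ J₀ ((J₀.support : Set X₁) \ ((J₀.support : Set X₁) \ (U : Set X₁))) := by
    rw [hZeq]
    exact hgood
  obtain ⟨J, hJeq, hJgood⟩ := h₃ p hp k X₁ f₁ hs hft hqc hi h4 hCM J₀ _ hZcl hZsub hgoodZ
  have hηZ : η ∉ (J₀.support : Set X₁) \ (U : Set X₁) := fun h => h.2 hηU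
  have hJη : stalkIdeal J η = Ideal.span (Set.range c') := by rw [hJeq η hηZ, hstalk]
  obtain ⟨hne, hle, hcharts⟩ := hfull
  refine ⟨J, n', c', ?_, ?_, hne, hle, fun j 𝔔 _ => hcharts j 𝔔, hJη, fun X₂ π hπ => ?_⟩
  · -- `J ≠ ⊥` since `J_η = (c′) ≠ ⊥`
    intro hJ
    apply hne
    rw [← hJη, hJ]
    exact stalkIdeal_bot η
  · -- `η ∈ supp J` since `J_η = (c′) ≤ 𝔪_η`
    have h := (mem_support_iff_stalkIdeal_le J η).mpr (by rw [hJη]; exact hle)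
    exact h
  · obtain ⟨hnc, hcl⟩ := hJgood X₂ π hπ
    exact ⟨fun x hx _ hxcl => hnc x hx hxcl, fun x hx hxcl => hcl x hx hxcl⟩

/-! ## §4 The splitter of the residual `FCUnguardedDimGe4` by the local dimension at `η` (new; res-L1-w45a-plan-1 R16.12 (2)/(3)) -/

/-- [OURS · CANDIDATE statement, not a fact] **FC″(dim ≥ 4) at a non-closed bad point of LOCAL DIMENSION ≤ 1** —
`FCUnguardedRungs.FCUnguardedDimGe4` VERBATIM with `ringKrullDim 𝒪_η ≤ 1 →` inserted before the conclusion: the PRIMARY CURVE RUNG of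
FC2Dim4Sig v0.5/v0.7 ((T1-wild-curve) + (T2) + (T3); under the CM hypothesis a bad non-closed `η` with `dim 𝒪_η ≤ 1` is a codimension-one
non-R₁ point — `dim 𝒪_η = 0` cannot occur, the generic stalk being a field — whose normalisation is an `𝔪_η`-primary blow-up with regular
charts [Liu2002, Thm. 8.1.24]; the spread and the closed points over `closure {η} ∖ U` are the (T3′) residual again). [candidate statement,
OURS; not proved here] -/
@[conjecture] def FCUnguardedLocDimLe1 : Prop :=
  ∀ (p : ℕ), p.Prime → ∀ (k : Type) [Field k] [CharP k p]
    (X₁ : Scheme.{0}) (f₁ : X₁ ⟶ Spec (.of k)),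
      IsSeparated f₁ → LocallyOfFiniteType f₁ → QuasiCompact f₁ → IsIntegral X₁ → 4 ≤ topologicalKrullDim X₁ →
      (∀ x : X₁, (∀ d : ℕ, ringKrullDim (X₁.presheaf.stalk x) = d → ∀ s : Fin d → X₁.presheaf.stalk x,
        (Ideal.span (Set.range s)).radical.IsMaximal → RingTheory.Sequence.IsWeaklyRegular (X₁.presheaf.stalk x) (List.ofFn s))) →
      ∀ η : X₁, (¬ IsClosed ({η} : Set X₁) ∧ ¬ (∀ d : ℕ, ringKrullDim (X₁.presheaf.stalk η) = d → ∀ s : Fin d → X₁.presheaf.stalk η,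
          (Ideal.span (Set.range s)).radical.IsMaximal → ∀ t : X₁.presheaf.stalk η, (∃ e : ℕ, t ^ p ^ e ∈
            Ideal.span ((fun z : X₁.presheaf.stalk η => z ^ p ^ e) '' (Ideal.span (Set.range s) : Set (X₁.presheaf.stalk η)))) →
              t ∈ Ideal.span (Set.range s)) ∧
        ∀ y : X₁, y ⤳ η → y ≠ η → (∀ d : ℕ, ringKrullDim (X₁.presheaf.stalk y) = d → ∀ s : Fin d → X₁.presheaf.stalk y,
          (Ideal.span (Set.range s)).radical.IsMaximal → ∀ t : X₁.presheaf.stalk y, (∃ e : ℕ, t ^ p ^ e ∈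
            Ideal.span ((fun z : X₁.presheaf.stalk y => z ^ p ^ e) '' (Ideal.span (Set.range s) : Set (X₁.presheaf.stalk y)))) →
              t ∈ Ideal.span (Set.range s))) →
      -- local dimension ≤ 1 at η (the primary curve rung)
      ringKrullDim (X₁.presheaf.stalk η) ≤ 1 →
      ∃ (J : X₁.IdealSheafData) (n' : ℕ) (c' : Fin n' → X₁.presheaf.stalk η), J ≠ ⊥ ∧ η ∈ (J.support : Set X₁) ∧
      Ideal.span (Set.range c') ≠ ⊥ ∧ Ideal.span (Set.range c') ≤ maximalIdeal (X₁.presheaf.stalk η) ∧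
        (∀ (j : Fin n') (𝔔 : PrimeSpectrum (blowupAlgebra (Ideal.span (Set.range c')) (c' j))),
          𝔔.asIdeal.comap (algebraMap (X₁.presheaf.stalk η) (blowupAlgebra (Ideal.span (Set.range c')) (c' j))) =
            maximalIdeal (X₁.presheaf.stalk η) →
          IsDomain (Localization.AtPrime 𝔔.asIdeal) ∧ ∀ d : ℕ, ringKrullDim (Localization.AtPrime 𝔔.asIdeal) = d →
            ∀ s : Fin d → Localization.AtPrime 𝔔.asIdeal, (Ideal.span (Set.range s)).radical.IsMaximal →
              RingTheory.Sequence.IsWeaklyRegular (Localization.AtPrime 𝔔.asIdeal) (List.ofFn s) ∧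
              ∀ y : Localization.AtPrime 𝔔.asIdeal, (∃ e : ℕ, y ^ p ^ e ∈ Ideal.span ((fun z : Localization.AtPrime 𝔔.asIdeal => z ^ p ^ e) ''
                (Ideal.span (Set.range s) : Set (Localization.AtPrime 𝔔.asIdeal)))) → y ∈ Ideal.span (Set.range s)) ∧
      stalkIdeal J η = Ideal.span (Set.range c') ∧
      (∀ (X₂ : Scheme.{0}) (π : X₂ ⟶ X₁), IsBlowup π J →
        (∀ x : X₂, π.base x ∈ (J.support : Set X₁) → π.base x ≠ η → ¬ IsClosed ({x} : Set X₂) →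
          IsDomain (X₂.presheaf.stalk x) ∧ ∀ d : ℕ, ringKrullDim (X₂.presheaf.stalk x) = d → ∀ s : Fin d → X₂.presheaf.stalk x,
            (Ideal.span (Set.range s)).radical.IsMaximal → RingTheory.Sequence.IsWeaklyRegular (X₂.presheaf.stalk x) (List.ofFn s) ∧
            ∀ t : X₂.presheaf.stalk x, (∃ e : ℕ, t ^ p ^ e ∈ Ideal.span ((fun z : X₂.presheaf.stalk x => z ^ p ^ e) ''
              (Ideal.span (Set.range s) : Set (X₂.presheaf.stalk x)))) → t ∈ Ideal.span (Set.range s)) ∧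
        (∀ x : X₂, π.base x ∈ (J.support : Set X₁) → IsClosed ({x} : Set X₂) →
          ∀ d : ℕ, ringKrullDim (X₂.presheaf.stalk x) = d → ∀ s : Fin d → X₂.presheaf.stalk x,
            (Ideal.span (Set.range s)).radical.IsMaximal → RingTheory.Sequence.IsWeaklyRegular (X₂.presheaf.stalk x) (List.ofFn s)))

/-- [OURS · CANDIDATE statement, not a fact] **FC″(dim ≥ 4) at a non-closed bad point of LOCAL DIMENSION ≥ 4** — `FCUnguardedRungs.FCUnguardedDimGe4`
VERBATIM with `4 ≤ ringKrullDim 𝒪_η →` inserted before the conclusion. Only inhabited on schemes of dimension ≥ 5 (`η` non-closed): the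
declared RESIDUAL of the d ≥ 5 recursion (the crux core one dimension up), carried, not attacked. [candidate statement, OURS; residual] -/
@[conjecture] def FCUnguardedLocDimGe4 : Prop :=
  ∀ (p : ℕ), p.Prime → ∀ (k : Type) [Field k] [CharP k p]
    (X₁ : Scheme.{0}) (f₁ : X₁ ⟶ Spec (.of k)),
      IsSeparated f₁ → LocallyOfFiniteType f₁ → QuasiCompact f₁ → IsIntegral X₁ → 4 ≤ topologicalKrullDim X₁ →
      (∀ x : X₁, (∀ d : ℕ, ringKrullDim (X₁.presheaf.stalk x) = d → ∀ s : Fin d → X₁.presheaf.stalk x,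
        (Ideal.span (Set.range s)).radical.IsMaximal → RingTheory.Sequence.IsWeaklyRegular (X₁.presheaf.stalk x) (List.ofFn s))) →
      ∀ η : X₁, (¬ IsClosed ({η} : Set X₁) ∧ ¬ (∀ d : ℕ, ringKrullDim (X₁.presheaf.stalk η) = d → ∀ s : Fin d → X₁.presheaf.stalk η,
          (Ideal.span (Set.range s)).radical.IsMaximal → ∀ t : X₁.presheaf.stalk η, (∃ e : ℕ, t ^ p ^ e ∈
            Ideal.span ((fun z : X₁.presheaf.stalk η => z ^ p ^ e) '' (Ideal.span (Set.range s) : Set (X₁.presheaf.stalk η)))) →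
              t ∈ Ideal.span (Set.range s)) ∧
        ∀ y : X₁, y ⤳ η → y ≠ η → (∀ d : ℕ, ringKrullDim (X₁.presheaf.stalk y) = d → ∀ s : Fin d → X₁.presheaf.stalk y,
          (Ideal.span (Set.range s)).radical.IsMaximal → ∀ t : X₁.presheaf.stalk y, (∃ e : ℕ, t ^ p ^ e ∈
            Ideal.span ((fun z : X₁.presheaf.stalk y => z ^ p ^ e) '' (Ideal.span (Set.range s) : Set (X₁.presheaf.stalk y)))) →
              t ∈ Ideal.span (Set.range s))) →
      -- local dimension ≥ 4 at η (only possible when dim X₁ ≥ 5)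
      4 ≤ ringKrullDim (X₁.presheaf.stalk η) →
      ∃ (J : X₁.IdealSheafData) (n' : ℕ) (c' : Fin n' → X₁.presheaf.stalk η), J ≠ ⊥ ∧ η ∈ (J.support : Set X₁) ∧
      Ideal.span (Set.range c') ≠ ⊥ ∧ Ideal.span (Set.range c') ≤ maximalIdeal (X₁.presheaf.stalk η) ∧
        (∀ (j : Fin n') (𝔔 : PrimeSpectrum (blowupAlgebra (Ideal.span (Set.range c')) (c' j))),
          𝔔.asIdeal.comap (algebraMap (X₁.presheaf.stalk η) (blowupAlgebra (Ideal.span (Set.range c')) (c' j))) =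
            maximalIdeal (X₁.presheaf.stalk η) →
          IsDomain (Localization.AtPrime 𝔔.asIdeal) ∧ ∀ d : ℕ, ringKrullDim (Localization.AtPrime 𝔔.asIdeal) = d →
            ∀ s : Fin d → Localization.AtPrime 𝔔.asIdeal, (Ideal.span (Set.range s)).radical.IsMaximal →
              RingTheory.Sequence.IsWeaklyRegular (Localization.AtPrime 𝔔.asIdeal) (List.ofFn s) ∧
              ∀ y : Localization.AtPrime 𝔔.asIdeal, (∃ e : ℕ, y ^ p ^ e ∈ Ideal.span ((fun z : Localization.AtPrime 𝔔.asIdeal => z ^ p ^ e) ''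
                (Ideal.span (Set.range s) : Set (Localization.AtPrime 𝔔.asIdeal)))) → y ∈ Ideal.span (Set.range s)) ∧
      stalkIdeal J η = Ideal.span (Set.range c') ∧
      (∀ (X₂ : Scheme.{0}) (π : X₂ ⟶ X₁), IsBlowup π J →
        (∀ x : X₂, π.base x ∈ (J.support : Set X₁) → π.base x ≠ η → ¬ IsClosed ({x} : Set X₂) →
          IsDomain (X₂.presheaf.stalk x) ∧ ∀ d : ℕ, ringKrullDim (X₂.presheaf.stalk x) = d → ∀ s : Fin d → X₂.presheaf.stalk x,
            (Ideal.span (Set.range s)).radical.IsMaximal → RingTheory.Sequence.IsWeaklyRegular (X₂.presheaf.stalk x) (List.ofFn s) ∧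
            ∀ t : X₂.presheaf.stalk x, (∃ e : ℕ, t ^ p ^ e ∈ Ideal.span ((fun z : X₂.presheaf.stalk x => z ^ p ^ e) ''
              (Ideal.span (Set.range s) : Set (X₂.presheaf.stalk x)))) → t ∈ Ideal.span (Set.range s)) ∧
        (∀ x : X₂, π.base x ∈ (J.support : Set X₁) → IsClosed ({x} : Set X₂) →
          ∀ d : ℕ, ringKrullDim (X₂.presheaf.stalk x) = d → ∀ s : Fin d → X₂.presheaf.stalk x,
            (Ideal.span (Set.range s)).radical.IsMaximal → RingTheory.Sequence.IsWeaklyRegular (X₂.presheaf.stalk x) (List.ofFn s)))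

/-- The local-dimension trichotomy in `WithBot ℕ∞`: `d ≤ 1`, or `2 ≤ d ≤ 3`, or `4 ≤ d`. [plumbing] -/
theorem locDim_trichotomy (d : WithBot ℕ∞) : d ≤ 1 ∨ (2 ≤ d ∧ d ≤ 3) ∨ 4 ≤ d := by
  induction d using WithBot.recBotCoe with
  | bot => exact Or.inl bot_le
  | coe a =>
    induction a using ENat.recTopCoe with
    | top =>
      refine Or.inr (Or.inr ?_)
      rw [← WithBot.coe_ofNat, WithBot.coe_le_coe]; exact le_top
    | coe n =>
      rcases Nat.lt_or_ge n 2 with h | h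
      · refine Or.inl ?_
        rw [← WithBot.coe_one, WithBot.coe_le_coe]
        exact_mod_cast (show n ≤ 1 by omega)
      · rcases Nat.lt_or_ge n 4 with h' | h'
        · refine Or.inr (Or.inl ⟨?_, ?_⟩)
          · rw [← WithBot.coe_ofNat, WithBot.coe_le_coe]
            exact_mod_cast h
          · rw [← WithBot.coe_ofNat, WithBot.coe_le_coe]
            exact_mod_cast (show n ≤ 3 by omega)
        · refine Or.inr (Or.inr ?_)
          rw [← WithBot.coe_ofNat, WithBot.coe_le_coe]
          exact_mod_cast h'

/-- **THE SPLITTER of the residual**: `FC″(dim ≥ 4) ⇐ (loc. dim ≤ 1 rung) + FCUnguardedLowDim + (loc. dim ≥ 4 residual)` — exhaustive by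
`locDim_trichotomy (ringKrullDim 𝒪_η)`. [plumbing] -/
theorem fcUnguardedDimGe4_of_parts (h₁ : FCUnguardedLocDimLe1) (h₂₃ : FCUnguardedLowDim) (h₄ : FCUnguardedLocDimGe4) :
    FCUnguardedRungs.FCUnguardedDimGe4 := by
  intro p hp k _ _ X₁ f₁ hs hft hqc hi h4 hCM η hη
  rcases locDim_trichotomy (ringKrullDim (X₁.presheaf.stalk η)) with hd | ⟨hd2, hd3⟩ | hd
  · exact h₁ p hp k X₁ f₁ hs hft hqc hi h4 hCM η hη hd
  · exact h₂₃ p hp k X₁ f₁ hs hft hqc hi h4 hCM η hη hd2 hd3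
  · exact h₄ p hp k X₁ f₁ hs hft hqc hi h4 hCM η hη hd

/-- **DOOR v30's `stub_fcUnguarded` THROUGH THE (A′) ROUTE**: `GenericFibreReduction.FCUnguarded` follows from the two low rungs
(`FCUnguardedDimLe2`, `FCUnguardedDimEq3`, both theorems modulo named facts in `FCUnguardedRungs` / `FCUnguardedDimEq3`), the primary
curve rung `FCUnguardedLocDimLe1`, the three (A′) inputs (T1″) `LocFixFullAtNonClosed`, (T2′) `SpreadGoodAprime`, (T3′)
`RelClosedSubsetFix`, and the d ≥ 5 residual `FCUnguardedLocDimGe4` — the decomposition door v31 registers. [OURS assembly; plumbing] -/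
theorem fcUnguarded_of_parts (h2 : FCUnguardedRungs.FCUnguardedDimLe2) (h3 : FCUnguardedDimEq3.FCUnguardedDimEq3)
    (h₁ : FCUnguardedLocDimLe1) (hT1 : LocFixFullAtNonClosed) (hT2 : SpreadGoodAprime) (hT3 : RelClosedSubsetFix)
    (h₄ : FCUnguardedLocDimGe4) : GenericFibreReduction.FCUnguarded :=
  FCUnguardedRungs.fcUnguarded_of_rungs h2 h3 (fcUnguardedDimGe4_of_parts h₁ (fcUnguardedLowDim_of_aprime hT1 hT2 hT3) h₄)

end Summit.ResolutionOfSingularities.ResolutionOfSingularities.Theorems.FInjectiveMacaulayfication.FCUnguardedAprime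

end
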